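import Literature.MathematicalPhysics.QuantumLattice.LiebRobinson
import Literature.MathematicalPhysics.QuantumLattice.MatrixProductStatesIntersectionProofs
import Literature.MathematicalPhysics.QuantumLattice.MatrixProductStatesPeriodicGroundStateProofs
import Literature.MathematicalPhysics.QuantumLattice.SpinChainsAkltUniqueProofs
import HarnessLib

/-!
# Discharged fact: a normal MPS is the unique ground state of its parent Hamiltonian on the ring

Trunk **T-QLATTICE**. Sibling proof file of
`Literature/MathematicalPhysics/QuantumLattice/LiebRobinson.lean` (theorem-only: no statement
or definition of that file is changed and no definition is introduced). It discharges the named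
fact (`def X : Prop`, D-0014)

* `Literature.MathematicalPhysics.QuantumLattice.fannes_nachtergaele_werner_unique`
  (**hubbard.S16**, Fannes–Nachtergaele–Werner uniqueness and ground-state property) — *for a
  normal MPS tensor `A` of positive bond dimension there is a block length `ℓ₀` such that for
  every `ℓ ≥ ℓ₀` and every ring `ℤ/L` with `L ≥ 2ℓ` the parent Hamiltonian
  `H = Σ_x h_{x,…,x+ℓ-1}` (`parentHamiltonian L ℓ A`) has a unique ground state and the periodic
  MPS `ringMPS L A` is a ground-state vector*

as `fannes_nachtergaele_werner_unique_holds`, with `ℓ₀ = m + 1` where `m ≥ 1` is a block length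
at which `A` is injective (`IsNormalMPS A`); in fact `L ≥ ℓ` suffices. The proof generalises,
from the AKLT tensor with `ℓ = 2` to an arbitrary tensor injective at a positive length `m` and
block length `m + 1`, the sibling files `MatrixProductStatesIntersectionProofs.lean` (FNW
Lemma 5.5 along the open chain) and `SpinChainsAkltUniqueProofs.lean` (ring closure, PVWC
Theorem 10), whose tensor-generic lemmas it reuses.

## Source

* D. Perez-Garcia, F. Verstraete, M. M. Wolf, J. I. Cirac, *Matrix product state
  representations*, Quantum Inf. Comput. **7** (2007) 401–430 (held:
  `paper:doi-10-26421-qic7-5-6-1`, arXiv:quant-ph/0608197), §4.1: Theorem 9 (p. 15, uniqueness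
  with OBC: "Any ground state `|φ⟩` of `H` verifies that `h_{j,j+1} ⊗ 𝟙|φ⟩ = 0` for every `j` …
  Mixing (19) for `j` and `j + 1` and using condition C1 for `B^{[j+1]}` gives
  `X^j B^{[j]} = B^{[j+2]} X^{j+1}`") and §4.1.2 Theorem 10 (p. 16, uniqueness with TI and PBC,
  `L > L₀`, `N ≥ 2L₀`): "Reasoning as in the case of OBC one can easily see that any ground
  state `|φ⟩` of `H_{𝒢_L}` is in `𝒢_N`, that is, has the form `Σ tr(X A_{i₁} ⋯ A_{i_N})|i₁ ⋯ i_N⟩`.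
  Since there is no distinguished first position, `|φ⟩` can also be written
  `Σ tr(A_{i₁} ⋯ A_{i_{L₀}} Y A_{i_{L₀+1}} ⋯ A_{i_N})`. By condition C1,
  `X A_{i₁} ⋯ A_{i_{L₀}} = A_{i₁} ⋯ A_{i_{L₀}} Y` … Hence `X = Y` which, in addition, commutes
  with `A_{i₁} ⋯ A_{i_{L₀}}` … `X = λ𝟙` and `|φ⟩ = |ψ⟩`."
* M. Fannes, B. Nachtergaele, R. F. Werner, *Finitely correlated states on quantum spin chains*,
  Comm. Math. Phys. **144** (1992) 443–490, §5: Def. 5.4 (`ker h = 𝒢_ℓ`), p. 468 ("the kernel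
  of `H_{{1,…,m}}` is clearly equal to the intersection of the kernels of the positive operators
  `h_k`"), Lemma 5.5 (pp. 468–469, intersection property
  `𝒢_m = ⋂_s ℋ^{⊗s} ⊗ 𝒢_ℓ ⊗ ℋ^{⊗(m-ℓ-s)}` for `ℓ ≥ ℓ₀ + 1`), Theorem 5.7 (p. 470, the
  infinite-chain uniqueness theorem of which the fact is the periodic-ring form).

The printed proofs use the normalisation `Σ_i A_i A_i† = 𝟙` (FNW (5.3.b); PVWC canonical form)
at one point of the gluing step; the vendored fact does not assume it, and it is replaced here by
the elementary `exists_eq_mul_of_forall_mul_eq_mul` (injectivity at a *positive* length `m`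
already gives `𝟙 ∈ span {A^{w'} A^{t}}`, which is all that is used).

## Proof

Let `A` be injective at the positive length `m` (hence at all lengths `≥ m`,
`IsInjectiveMPS.of_le`), `ℓ = m' + 1` with `m' ≥ m`, and `ℓ ≤ L`.

1. `exists_mpsWithBoundary_of_parentLocalTerm_mulVec_eq_zero'` — `ker h ⊆ 𝒢_ℓ = {ψ_B}`:
   `h = projMatrix 𝒢_ℓᗮ` and `𝒢_ℓᗮᗮ = 𝒢_ℓ` (Mathlib `Submodule.starProjection_apply_eq_zero_iff`,
   `Submodule.orthogonal_orthogonal`), and `𝒢_ℓ = span {ψ_B}` consists of the `ψ_B`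
   (`exists_mpsWithBoundary_of_mem_mpsRange`, linearity of `B ↦ ψ_B`). FNW Def. 5.4.
2. `exists_boundary_of_parentHamiltonian_mulVec_eq_zero'` — `H φ = 0` forces every translate
   `h_x` to kill `φ` (`mulVec_eq_zero_of_sum_posSemidef`, positivity), and `h_x = h ⊗ 𝟙` acts by
   `h` on the block slices of `φ` (`localOp_mulVec_extend_val`, relabelled along `i ↦ x + i`,
   `ringBlockSite_bijective`), so every block slice of `φ` is a `ψ_B`. FNW p. 468.
3. `exists_eq_mul_of_forall_mul_eq_mul`, `exists_boundary_of_snoc_of_cons_of_pos` — the gluing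
   step of FNW Lemma 5.5 without normalisation: from `ψ(w t) = tr (B_t A^w)` and
   `ψ(s w) = tr (C_s A^w)` one gets `B_t A^s = A^t C_s` by injectivity on the middle word
   (`eq_of_trace_mul_wordProduct_eq`), then `C_s = X A^s` and `ψ = ψ_X`.
4. `blockSlices_snoc`, `blockSlices_cons`, `exists_boundary_of_blockSlices` — the open chain
   (PVWC Thm 9 / FNW Lemma 5.5 iterated): a vector on `n ≥ ℓ` sites all of whose `ℓ`-block
   slices lie in `𝒢_ℓ` is a boundary MPS `ψ_X` on `n` sites (induction on `n`).
5. `exists_eq_smul_ringMPS` — PVWC Thm 10: reading the ring `ℤ/L` from an origin `k` turns `φ`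
   into such a vector, so `φ(σ) = tr (X_k A^{σ_k} ⋯ A^{σ_{k+L-1}})`; comparing `k` and `k + 1`
   gives `X_k A^s = A^s X_{k+1}` (injectivity at length `L - 1 ≥ m`), so `X_0` commutes with all
   words of length `L` and is a scalar (`exists_eq_smul_one_of_commute_wordProduct`):
   `φ = c ψ_L`, `ψ_L = ringMPS L A`.
6. `ringMPS_ne_zero` — `ψ_L ≠ 0` for `L ≥ m` and `D > 0` (else the trace would vanish on the
   spanning words of length `L`, but `tr 𝟙 = D`).
7. `fannes_nachtergaele_werner_unique_holds` — `H ≥ 0` (`parentHamiltonian_posSemidef_holds`),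
   `H ψ_L = 0` (`parentHamiltonian_mulVec_mps_eq_zero_holds`) and `ψ_L ≠ 0` give ground energy
   `0` (`groundEnergy_eq_of_posSemidef_sub`), so `ψ_L` is a ground-state vector and the ground
   space is `ker H = ℂ ψ_L` (by 2 and 5), of dimension `1`.

## References

* D. Perez-Garcia, F. Verstraete, M. M. Wolf, J. I. Cirac, Quantum Inf. Comput. **7** (2007)
  401–430, doi:10.26421/qic7.5-6-1, arXiv:quant-ph/0608197, §4.1.1 Theorem 9, §4.1.2
  Theorem 10. [PerezGarciaVerstraeteWolfCiracQIC2007]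
* M. Fannes, B. Nachtergaele, R. F. Werner, Comm. Math. Phys. **144** (1992) 443–490,
  doi:10.1007/bf02099178, §5 Def. 5.4, p. 468, Lemma 5.5, Theorem 5.7.
  [FannesNachtergaeleWernerCMP1992]
-/

noncomputable section

open Matrix
open scoped ComplexOrder MatrixOrder

namespace Literature.MathematicalPhysics.QuantumLattice

section QLattice

variable {q D : ℕ}

/-! ### Linearity of `B ↦ ψ_B` and the kernel of the local term -/

/-- `ψ_{B + B'} = ψ_B + ψ_{B'}`. [folklore] -/
theorem mpsWithBoundary_add (L : ℕ) (A : MPSTensor q D) (B B' : Matrix (Fin D) (Fin D) ℂ) :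
    mpsWithBoundary L A (B + B') = mpsWithBoundary L A B + mpsWithBoundary L A B' := by
  funext σ
  simp [mpsWithBoundary, Matrix.add_mul, trace_add]

/-- `ψ_{c B} = c ψ_B`. [folklore] -/
theorem mpsWithBoundary_smul (L : ℕ) (A : MPSTensor q D) (c : ℂ) (B : Matrix (Fin D) (Fin D) ℂ) :
    mpsWithBoundary L A (c • B) = c • mpsWithBoundary L A B := by
  funext σ
  simp [mpsWithBoundary, trace_smul]

/-- `ψ_0 = 0`. [folklore] -/
@[simp]
theorem mpsWithBoundary_zero (L : ℕ) (A : MPSTensor q D) :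
    mpsWithBoundary L A 0 = 0 := by
  funext σ
  simp [mpsWithBoundary]

/-- Every element of `𝒢_ℓ = span {ψ_B}` is of the form `ψ_B` (the map `B ↦ ψ_B` is linear, so
its range is already a subspace). Fannes–Nachtergaele–Werner (1992) §5, eq. (5.5)
(`𝒢_n = Γ_n(ℬ)`). [folklore] -/
theorem exists_mpsWithBoundary_of_mem_mpsRange (ℓ : ℕ) (A : MPSTensor q D)
    {x : SpinSpace (Fin ℓ) q} (hx : x ∈ mpsRange ℓ A) :
    ∃ B : Matrix (Fin D) (Fin D) ℂ, WithLp.toLp 2 (mpsWithBoundary ℓ A B) = x := by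
  induction hx using Submodule.span_induction with
  | mem x hx =>
    obtain ⟨B, rfl⟩ := hx
    exact ⟨B, rfl⟩
  | zero => exact ⟨0, by simp⟩
  | add x y _ _ hx hy =>
    obtain ⟨B, rfl⟩ := hx
    obtain ⟨B', rfl⟩ := hy
    exact ⟨B + B', by rw [mpsWithBoundary_add, WithLp.toLp_add]⟩
  | smul c x _ hx =>
    obtain ⟨B, rfl⟩ := hx
    exact ⟨c • B, by rw [mpsWithBoundary_smul, WithLp.toLp_smul]⟩

/-- **`ker h ⊆ 𝒢_ℓ`.** A vector annihilated by the local term `h = 1 - P_{𝒢_ℓ}` (the orthogonal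
projection onto `𝒢_ℓᗮ`) lies in `𝒢_ℓᗮᗮ = 𝒢_ℓ`, hence is a boundary MPS `ψ_B`.
Fannes–Nachtergaele–Werner (1992) §5, Def. 5.4 ("the kernel of `h` coincides with
`𝒢_ℓ = Γ_ℓ(ℬ)`"). [cite: FannesNachtergaeleWernerCMP1992, §5 Def. 5.4] -/
theorem exists_mpsWithBoundary_of_parentLocalTerm_mulVec_eq_zero' (ℓ : ℕ) (A : MPSTensor q D)
    (u : (Fin ℓ → Fin q) → ℂ) (hu : parentLocalTerm ℓ A *ᵥ u = 0) :
    ∃ B : Matrix (Fin D) (Fin D) ℂ, mpsWithBoundary ℓ A B = u := by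
  have hP := projMatrix_mulVec (mpsRange ℓ A)ᗮ (WithLp.toLp 2 u)
  unfold parentLocalTerm at hu
  simp only [hu] at hP
  have h0 : (mpsRange ℓ A)ᗮ.starProjection (WithLp.toLp 2 u) = 0 :=
    (WithLp.ofLp_eq_zero 2).1 hP.symm
  rw [Submodule.starProjection_apply_eq_zero_iff, Submodule.orthogonal_orthogonal] at h0
  obtain ⟨B, hB⟩ := exists_mpsWithBoundary_of_mem_mpsRange ℓ A h0
  exact ⟨B, (WithLp.toLp_injective 2) hB⟩

/-! ### The unnormalised gluing step -/

/-- **Left factorisation from the exchange relation.** If the words of a *positive* length `m`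
span `M_D(ℂ)` and two families of matrices satisfy `B_t A^s = A^t C_s` for all letters `s, t`,
then `C_s = X A^s` for a single matrix `X`: writing `𝟙 = Σ_w c_w A^{w'} A^{t_w}` as a combination
of words of length `m ≥ 1` split before their last letter,
`C_s = Σ_w c_w A^{w'} A^{t_w} C_s = (Σ_w c_w A^{w'} B_{t_w}) A^s`. This replaces the normalisation
`Σ_s A^s A^{s†} = 𝟙` used at this point in Fannes–Nachtergaele–Werner (1992), proof of
Lemma 5.5 (eq. (5.3.b)), and in Perez-Garcia–Verstraete–Wolf–Cirac (2007) §4.1.1. [folklore] -/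
theorem exists_eq_mul_of_forall_mul_eq_mul {A : MPSTensor q D} {m : ℕ} (hinj : IsInjectiveMPS A m)
    (hm : 0 < m) {B C : Fin q → Matrix (Fin D) (Fin D) ℂ}
    (key : ∀ s t : Fin q, B t * A s = A t * C s) :
    ∃ X : Matrix (Fin D) (Fin D) ℂ, ∀ s, C s = X * A s := by
  suffices h : ∀ Y ∈ Submodule.span ℂ (Set.range (wordProduct (ℓ := m) A)),
      ∃ X : Matrix (Fin D) (Fin D) ℂ, ∀ s, Y * C s = X * A s by
    obtain ⟨X, hX⟩ := h 1 (by rw [hinj]; exact Submodule.mem_top)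
    exact ⟨X, fun s => by rw [← hX s, Matrix.one_mul]⟩
  intro Y hY
  induction hY using Submodule.span_induction with
  | mem Y hY =>
    obtain ⟨w, rfl⟩ := hY
    obtain ⟨k, rfl⟩ : ∃ k, m = k + 1 := ⟨m - 1, by omega⟩
    refine ⟨wordProduct A (Fin.init w) * B (w (Fin.last k)), fun s => ?_⟩
    rw [← Fin.snoc_init_self w, wordProduct_snoc, Fin.snoc_init_self, Matrix.mul_assoc,
      Matrix.mul_assoc, key]
  | zero => exact ⟨0, fun s => by simp⟩
  | add Y Z _ _ hY hZ =>
    obtain ⟨X, hX⟩ := hY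
    obtain ⟨X', hX'⟩ := hZ
    exact ⟨X + X', fun s => by rw [Matrix.add_mul, Matrix.add_mul, hX, hX']⟩
  | smul c Y _ hY =>
    obtain ⟨X, hX⟩ := hY
    exact ⟨c • X, fun s => by rw [Matrix.smul_mul, Matrix.smul_mul, hX]⟩

/-- **Fannes–Nachtergaele–Werner, Lemma 5.5 (inductive step of the intersection property),
without normalisation.** Let the words of a positive length `m ≤ n` span `M_D(ℂ)`. If a vector
`ψ` on `n + 2` sites is, for each frozen last letter `t`, a boundary MPS `ψ_{B_t}` in the first
`n + 1` letters, and for each frozen first letter `s` a boundary MPS `ψ_{C_s}` in the last `n + 1`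
letters, then `ψ = ψ_X` on all `n + 2` sites. Comparing the two expressions on words `s w t`,
`tr (B_t A^s A^w) = tr (C_s A^w A^t)` for all `w` of length `n ≥ m`, so `B_t A^s = A^t C_s` by
injectivity (`eq_of_trace_mul_wordProduct_eq`), whence `C_s = X A^s`
(`exists_eq_mul_of_forall_mul_eq_mul`) and `ψ(s w) = tr (C_s A^w) = tr (X A^s A^w)`.
Fannes–Nachtergaele–Werner, CMP 144 (1992), Lemma 5.5, pp. 468–469;
Perez-Garcia–Verstraete–Wolf–Cirac (2007) §4.1.1, proof of Theorem 9.
[cite: FannesNachtergaeleWernerCMP1992, §5 Lemma 5.5] -/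
theorem exists_boundary_of_snoc_of_cons_of_pos {A : MPSTensor q D} {m n : ℕ}
    (hinj : IsInjectiveMPS A m) (hm : 0 < m) (hmn : m ≤ n) (ψ : (Fin (n + 2) → Fin q) → ℂ)
    (hB : ∀ t : Fin q, ∃ B : Matrix (Fin D) (Fin D) ℂ, ∀ w : Fin (n + 1) → Fin q,
      ψ (Fin.snoc w t) = mpsWithBoundary (n + 1) A B w)
    (hC : ∀ s : Fin q, ∃ C : Matrix (Fin D) (Fin D) ℂ, ∀ w : Fin (n + 1) → Fin q,
      ψ (Fin.cons s w) = mpsWithBoundary (n + 1) A C w) :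
    ∃ X : Matrix (Fin D) (Fin D) ℂ, ∀ w, ψ w = mpsWithBoundary (n + 2) A X w := by
  choose B hB using hB
  choose C hC using hC
  have key : ∀ s t : Fin q, B t * A s = A t * C s := by
    intro s t
    refine eq_of_trace_mul_wordProduct_eq (hinj.of_le hm hmn) fun w => ?_
    have h1 := hB t (Fin.cons s w)
    have h2 := hC s (Fin.snoc w t)
    rw [Fin.cons_snoc_eq_snoc_cons, h1, mpsWithBoundary, mpsWithBoundary, wordProduct_cons,
      wordProduct_snoc] at h2
    rw [Matrix.mul_assoc, h2, Matrix.mul_assoc, trace_mul_cycle']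
  obtain ⟨X, hX⟩ := exists_eq_mul_of_forall_mul_eq_mul hinj hm key
  refine ⟨X, fun w => ?_⟩
  rw [← Fin.cons_self_tail w, hC, mpsWithBoundary, mpsWithBoundary, wordProduct_cons, hX,
    Matrix.mul_assoc]

/-! ### The periodic MPS of an injective tensor is nonzero -/

/-- For a tensor of positive bond dimension whose words of length `m` span `M_D(ℂ)`, the periodic
MPS `ψ_L = tr (A^{σ₀} ⋯ A^{σ_{L-1}})` on a ring of `L ≥ m` sites (`m ≥ 1`) is not the zero
vector: otherwise the trace would vanish on all words of length `L`, which span `M_D(ℂ) ∋ 𝟙`,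
whereas `tr 𝟙 = D ≠ 0`. Perez-Garcia–Verstraete–Wolf–Cirac (2007) §3.2.4 (Condition C1).
[folklore] -/
theorem ringMPS_ne_zero [NeZero D] {A : MPSTensor q D} {m : ℕ} (hinj : IsInjectiveMPS A m)
    (hm : 0 < m) (L : ℕ) [NeZero L] (hL : m ≤ L) : ringMPS L A ≠ 0 := by
  intro h0
  haveI : Nonempty (Fin D) := ⟨⟨0, Nat.pos_of_ne_zero (NeZero.ne D)⟩⟩
  have htr : ∀ w : Fin L → Fin q, (wordProduct A w).trace = 0 := by
    intro w
    have h1 := congrFun h0 (w ∘ (ZMod.finEquiv L).symm)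
    change mpsPeriodic L A ((w ∘ (ZMod.finEquiv L).symm) ∘ ZMod.finEquiv L) = 0 at h1
    have hcomp : (w ∘ (ZMod.finEquiv L).symm) ∘ ZMod.finEquiv L = w := by
      funext i
      simp
    rwa [hcomp, mpsPeriodic_apply] at h1
  have h10 : (1 : Matrix (Fin D) (Fin D) ℂ) = 0 :=
    eq_of_trace_mul_wordProduct_eq (hinj.of_le hm hL) fun w => by
      rw [Matrix.one_mul, Matrix.zero_mul, trace_zero, htr]
  exact one_ne_zero h10

/-! ### The open chain: block slices and the iterated intersection property -/

/-- Restricting a vector on `n + 1` sites to a frozen last letter preserves the property that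
every `ℓ`-block slice is a boundary MPS on `ℓ` sites. [folklore] -/
theorem blockSlices_snoc {A : MPSTensor q D} {ℓ n : ℕ} (ψ : (Fin (n + 1) → Fin q) → ℂ)
    (hψ : ∀ (j : ℕ) (hj : j + ℓ ≤ n + 1) (σ : Fin (n + 1) → Fin q),
      ∃ B : Matrix (Fin D) (Fin D) ℂ, ∀ τ : Fin (n + 1) → Fin q,
        (∀ i : Fin (n + 1), (i : ℕ) < j ∨ j + ℓ ≤ (i : ℕ) → σ i = τ i) →
          ψ τ = mpsWithBoundary ℓ A B (fun i : Fin ℓ => τ ⟨j + i, by omega⟩))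
    (t : Fin q) :
    ∀ (j : ℕ) (hj : j + ℓ ≤ n) (σ : Fin n → Fin q),
      ∃ B : Matrix (Fin D) (Fin D) ℂ, ∀ τ : Fin n → Fin q,
        (∀ i : Fin n, (i : ℕ) < j ∨ j + ℓ ≤ (i : ℕ) → σ i = τ i) →
          ψ (Fin.snoc τ t) = mpsWithBoundary ℓ A B (fun i : Fin ℓ => τ ⟨j + i, by omega⟩) := by
  intro j hj σ
  obtain ⟨B, hB⟩ := hψ j (by omega) (Fin.snoc σ t)
  refine ⟨B, fun τ hτ => ?_⟩
  have h := hB (Fin.snoc τ t) fun i hi => by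
    by_cases hil : i = Fin.last n
    · subst hil
      simp [Fin.snoc_last]
    · obtain ⟨i', rfl⟩ := Fin.exists_castSucc_eq.2 hil
      rw [Fin.snoc_castSucc, Fin.snoc_castSucc]
      exact hτ i' (by simpa using hi)
  rw [h]
  congr 1
  funext i
  have hi : (⟨j + (i : ℕ), by omega⟩ : Fin (n + 1)) = Fin.castSucc ⟨j + i, by omega⟩ := rfl
  rw [hi, Fin.snoc_castSucc]

/-- Restricting a vector on `n + 1` sites to a frozen first letter preserves the property that
every `ℓ`-block slice is a boundary MPS (block `j` of the restriction is block `j + 1` of `ψ`).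
[folklore] -/
theorem blockSlices_cons {A : MPSTensor q D} {ℓ n : ℕ} (ψ : (Fin (n + 1) → Fin q) → ℂ)
    (hψ : ∀ (j : ℕ) (hj : j + ℓ ≤ n + 1) (σ : Fin (n + 1) → Fin q),
      ∃ B : Matrix (Fin D) (Fin D) ℂ, ∀ τ : Fin (n + 1) → Fin q,
        (∀ i : Fin (n + 1), (i : ℕ) < j ∨ j + ℓ ≤ (i : ℕ) → σ i = τ i) →
          ψ τ = mpsWithBoundary ℓ A B (fun i : Fin ℓ => τ ⟨j + i, by omega⟩))
    (s : Fin q) :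
    ∀ (j : ℕ) (hj : j + ℓ ≤ n) (σ : Fin n → Fin q),
      ∃ B : Matrix (Fin D) (Fin D) ℂ, ∀ τ : Fin n → Fin q,
        (∀ i : Fin n, (i : ℕ) < j ∨ j + ℓ ≤ (i : ℕ) → σ i = τ i) →
          ψ (Fin.cons s τ) = mpsWithBoundary ℓ A B (fun i : Fin ℓ => τ ⟨j + i, by omega⟩) := by
  intro j hj σ
  obtain ⟨B, hB⟩ := hψ (j + 1) (by omega) (Fin.cons s σ)
  refine ⟨B, fun τ hτ => ?_⟩
  have h := hB (Fin.cons s τ) fun i hi => by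
    by_cases hi0 : i = 0
    · subst hi0
      rfl
    · obtain ⟨i', rfl⟩ := Fin.exists_succ_eq.2 hi0
      rw [Fin.cons_succ, Fin.cons_succ]
      refine hτ i' ?_
      simp only [Fin.val_succ] at hi
      omega
  rw [h]
  congr 1
  funext i
  have : (⟨j + 1 + (i : ℕ), by omega⟩ : Fin (n + 1)) = Fin.succ ⟨j + i, by omega⟩ :=
    Fin.ext (by simp; omega)
  rw [this, Fin.cons_succ]

/-- **Kernel of the open-chain parent Hamiltonian is `𝒢_n` (FNW Lemma 5.5, iterated;
PVWC Theorem 9 without normalisation).** Let the words of a positive length `m` span `M_D(ℂ)`.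
For every `n ≥ m + 1`, a vector `ψ` on `n` sites all of whose `(m+1)`-block slices are boundary
MPS `ψ_B` on `m + 1` sites is itself a boundary MPS `ψ_X` on `n` sites:
`⋂_j ℋ^{⊗j} ⊗ 𝒢_{m+1} ⊗ ℋ^{⊗(n-j-m-1)} = 𝒢_n`. Induction on `n`: the restrictions to a frozen last
(resp. first) letter inherit the hypothesis (`blockSlices_snoc`, `blockSlices_cons`), and the
two resulting representations glue by `exists_boundary_of_snoc_of_cons_of_pos` (injectivity at
length `n - 1 ≥ m`). Fannes–Nachtergaele–Werner, CMP 144 (1992), Lemma 5.5 (pp. 468–469);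
Perez-Garcia–Verstraete–Wolf–Cirac (2007) §4.1.1 Theorem 9, §4.1.2 ("any ground state of
`H_{𝒢_L}` is in `𝒢_N`"). [cite: PerezGarciaVerstraeteWolfCiracQIC2007, §4.1.1 Theorem 9] -/
theorem exists_boundary_of_blockSlices {A : MPSTensor q D} {m : ℕ} (hinj : IsInjectiveMPS A m)
    (hm : 0 < m) (n : ℕ) (hn : m + 1 ≤ n) (ψ : (Fin n → Fin q) → ℂ)
    (hψ : ∀ (j : ℕ) (hj : j + (m + 1) ≤ n) (σ : Fin n → Fin q),
      ∃ B : Matrix (Fin D) (Fin D) ℂ, ∀ τ : Fin n → Fin q,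
        (∀ i : Fin n, (i : ℕ) < j ∨ j + (m + 1) ≤ (i : ℕ) → σ i = τ i) →
          ψ τ = mpsWithBoundary (m + 1) A B (fun i : Fin (m + 1) => τ ⟨j + i, by omega⟩)) :
    ∃ X : Matrix (Fin D) (Fin D) ℂ, ∀ w, ψ w = mpsWithBoundary n A X w := by
  induction n, hn using Nat.le_induction with
  | base =>
    rcases isEmpty_or_nonempty (Fin (m + 1) → Fin q) with hq | hne
    · exact ⟨0, fun w => (IsEmpty.false w).elim⟩
    · obtain ⟨B, hB⟩ := hψ 0 (by omega) hne.some
      refine ⟨B, fun w => ?_⟩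
      rw [hB w fun i h => absurd i.isLt (by omega)]
      congr 1
      funext i
      congr 1
      exact Fin.ext (by simp)
  | succ n hn ih =>
    -- boundary data from the induction hypothesis applied to the restrictions
    have hB : ∀ t : Fin q, ∃ B : Matrix (Fin D) (Fin D) ℂ, ∀ w : Fin n → Fin q,
        ψ (Fin.snoc w t) = mpsWithBoundary n A B w := fun t =>
      ih (fun w => ψ (Fin.snoc w t)) (blockSlices_snoc ψ hψ t)
    have hC : ∀ s : Fin q, ∃ C : Matrix (Fin D) (Fin D) ℂ, ∀ w : Fin n → Fin q,
        ψ (Fin.cons s w) = mpsWithBoundary n A C w := fun s =>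
      ih (fun w => ψ (Fin.cons s w)) (blockSlices_cons ψ hψ s)
    obtain ⟨n', rfl⟩ : ∃ n', n = n' + 1 := ⟨n - 1, by omega⟩
    exact exists_boundary_of_snoc_of_cons_of_pos hinj hm (by omega) ψ hB hC

/-! ### The ring: every block slice of a zero-energy vector is a boundary MPS -/

/-- **Zero-energy vectors of the parent Hamiltonian have all block slices in `𝒢_ℓ`.** For
`ℓ ≤ L`, if `H φ = 0` for the parent Hamiltonian `H = Σ_x h_{x,…,x+ℓ-1}` of the tensor `A` on the
ring `ℤ/L`, then along every block `{x, …, x+ℓ-1}` and for every frozen configuration off the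
block the slice of `φ` is a boundary MPS `ψ_B` (the hypothesis of
`parentHamiltonian_mulVec_eq_zero_of_exists_boundary`): `H φ = 0` forces `h_x φ = 0` for each `x`
(positivity, `mulVec_eq_zero_of_sum_posSemidef`), `h_x = h ⊗ 𝟙` acts by `h` on the block slices
(`localOp_mulVec_extend_val`, relabelled along the bijection `i ↦ x + i`, `ringBlockSite_bijective`),
and `ker h = 𝒢_ℓ` (`exists_mpsWithBoundary_of_parentLocalTerm_mulVec_eq_zero'`).
Fannes–Nachtergaele–Werner (1992) §5, p. 468 ("the kernel of `H_{{1,…,m}}` is clearly equal to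
the intersection of the kernels of the positive operators `h_k`") and Def. 5.4;
Perez-Garcia–Verstraete–Wolf–Cirac (2007) §4.1.2, proof of Theorem 10 ("any ground state `|φ⟩`
of `H_{𝒢_L}` …"). [cite: FannesNachtergaeleWernerCMP1992, §5 Def. 5.4 and p. 468] -/
theorem exists_boundary_of_parentHamiltonian_mulVec_eq_zero' (L : ℕ) [NeZero L] {ℓ : ℕ}
    (hℓ : ℓ ≤ L) (A : MPSTensor q D) (φ : TensorIndex (ZMod L) q → ℂ)
    (h0 : parentHamiltonian L ℓ A *ᵥ φ = 0) (x : ZMod L) (σ : TensorIndex (ZMod L) q) :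
    ∃ B : Matrix (Fin D) (Fin D) ℂ, ∀ τ : TensorIndex (ZMod L) q,
      (∀ y, y ∉ ringBlock L ℓ x → σ y = τ y) →
        φ τ = mpsWithBoundary ℓ A B (fun i : Fin ℓ => τ (x + ((i : ℕ) : ZMod L))) := by
  -- the block term at `x` kills `φ`
  have hx : localOp (ringBlock L ℓ x) (onRingBlock L ℓ x (parentLocalTerm ℓ A)) *ᵥ φ = 0 := by
    unfold parentHamiltonian at h0
    exact mulVec_eq_zero_of_sum_posSemidef (fun y _ => posSemidef_localOp _
      (posSemidef_onRingBlock L ℓ y (parentLocalTerm_posSemidef ℓ A))) h0 x (Finset.mem_univ x)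
  -- hence `h` kills the block slice of `φ` at `σ`, relabelled by `Fin ℓ`
  have hf : Function.Bijective fun (ρ : ringBlock L ℓ x → Fin q) (i : Fin ℓ) =>
      ρ (ringBlockSite L ℓ x i) :=
    (ringBlockSite_bijective L ℓ hℓ x).comp_right
  set g := Equiv.ofBijective _ hf with hg
  have hslice := localOp_mulVec_extend_val (ringBlock L ℓ x)
    (onRingBlock L ℓ x (parentLocalTerm ℓ A)) φ σ
  rw [hx] at hslice
  have hker : parentLocalTerm ℓ A *ᵥ
      ((fun β : ringBlock L ℓ x → Fin q => φ (Subtype.val.extend β σ)) ∘ g.symm) = 0 := by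
    have h2 : (parentLocalTerm ℓ A).submatrix g g *ᵥ
        (fun β : ringBlock L ℓ x → Fin q => φ (Subtype.val.extend β σ)) = 0 := hslice.symm
    rw [submatrix_mulVec_equiv] at h2
    funext w
    have h3 := congrFun h2 (g.symm w)
    simpa using h3
  obtain ⟨B, hB⟩ := exists_mpsWithBoundary_of_parentLocalTerm_mulVec_eq_zero' _ _ _ hker
  refine ⟨B, fun τ hτ => ?_⟩
  have hβ : φ τ = mpsWithBoundary ℓ A B (g fun y : ringBlock L ℓ x => τ y) := by
    have h4 := congrFun hB (g fun y : ringBlock L ℓ x => τ y)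
    simp only [Function.comp_apply, Equiv.symm_apply_apply] at h4
    rw [h4, extend_val_restrict_eq_of_forall _ hτ]
  rw [hβ]
  rfl

/-! ### Ring closure (Perez-Garcia–Verstraete–Wolf–Cirac, Theorem 10) -/

/-- **Uniqueness on the ring (PVWC Theorem 10).** Let the words of a positive length `m` span
`M_D(ℂ)` and `N ≥ m + 1`. If every `(m+1)`-block slice of a vector `φ` on the ring `ℤ/N` is a
boundary MPS `ψ_B` (i.e. `φ` is annihilated by every translate of `h = 1 - P_{𝒢_{m+1}}`), then
`φ` is a multiple of the periodic MPS `ψ_N = tr (A^{σ₀} ⋯ A^{σ_{N-1}})`.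
Proof as printed: reading the ring from any origin `k`, the open-chain result
(`exists_boundary_of_blockSlices`) gives `φ(σ) = tr (X_k A^{σ_k} ⋯ A^{σ_{k+N-1}})` ("any ground
state of `H_{𝒢_L}` is in `𝒢_N`"); comparing the origins `k` and `k + 1` ("there is no
distinguished first position") by injectivity on words of length `N - 1 ≥ m` gives
`X_k A^s = A^s X_{k+1}`, hence `X_0` commutes with all words of length `N` and is a scalar
(`exists_eq_smul_one_of_commute_wordProduct`: "`X` commutes with every matrix and hence
`X = λ𝟙` and `|φ⟩ = |ψ⟩`"). Perez-Garcia–Verstraete–Wolf–Cirac, QIC 7 (2007), §4.1.2,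
Theorem 10; Fannes–Nachtergaele–Werner (1992) Theorem 5.7 is the infinite-chain analogue.
[cite: PerezGarciaVerstraeteWolfCiracQIC2007, §4.1.2 Theorem 10] -/
theorem exists_eq_smul_ringMPS {A : MPSTensor q D} {m : ℕ} (hinj : IsInjectiveMPS A m)
    (hm : 0 < m) (N : ℕ) [NeZero N] (hN : m + 1 ≤ N) (φ : TensorIndex (ZMod N) q → ℂ)
    (hφ : ∀ (x : ZMod N) (σ : TensorIndex (ZMod N) q), ∃ B : Matrix (Fin D) (Fin D) ℂ,
      ∀ τ : TensorIndex (ZMod N) q, (∀ y, y ∉ ringBlock N (m + 1) x → σ y = τ y) →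
        φ τ = mpsWithBoundary (m + 1) A B (fun i : Fin (m + 1) => τ (x + ((i : ℕ) : ZMod N)))) :
    ∃ c : ℂ, φ = c • ringMPS N A := by
  -- reading the ring from the origin `k`: `i ↦ k + i`
  set e : ZMod N → Fin N ≃ ZMod N := fun k =>
    (ZMod.finEquiv N).toEquiv.trans (Equiv.addLeft k) with he_def
  have he : ∀ (k : ZMod N) (i : Fin N), e k i = k + ((i : ℕ) : ZMod N) := fun k i => by
    simp [he_def, finEquiv_apply_eq_natCast]
  -- Step 1: along every origin, `φ` is an open-chain boundary MPS ("`φ ∈ 𝒢_N`")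
  have hX : ∀ k : ZMod N, ∃ X : Matrix (Fin D) (Fin D) ℂ, ∀ τ : TensorIndex (ZMod N) q,
      φ τ = (X * wordProduct A (τ ∘ e k)).trace := by
    intro k
    obtain ⟨X, hXw⟩ := exists_boundary_of_blockSlices hinj hm N hN
      (fun w => φ (w ∘ (e k).symm)) fun j hj σ => by
        obtain ⟨B, hB⟩ := hφ (e k ⟨j, by omega⟩) (σ ∘ (e k).symm)
        refine ⟨B, fun τ hτ => ?_⟩
        have hmem : ∀ i : Fin (m + 1),
            e k ⟨j + i, by omega⟩ ∈ ringBlock N (m + 1) (e k ⟨j, by omega⟩) :=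
          fun i => (mem_ringBlock_iff _ _).2 ⟨i, by rw [he, he]; push_cast; ring⟩
        have h := hB (τ ∘ (e k).symm) fun y hy => by
          simp only [Function.comp_apply]
          refine hτ _ ?_
          by_contra hcon
          apply hy
          have hi₀ : (⟨j + (((e k).symm y : ℕ) - j), by omega⟩ : Fin N) = (e k).symm y :=
            Fin.ext (by simp only; omega)
          have hy' : y = e k ⟨j + (((e k).symm y : ℕ) - j), by omega⟩ := by
            rw [hi₀, Equiv.apply_symm_apply]
          rw [hy']
          exact hmem ⟨((e k).symm y : ℕ) - j, by omega⟩
        rw [h]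
        congr 1
        funext i
        simp only [Function.comp_apply]
        congr 1
        rw [Equiv.symm_apply_eq, he, he]
        push_cast
        ring
    refine ⟨X, fun τ => ?_⟩
    have h := hXw (τ ∘ e k)
    rw [Function.comp_assoc, Equiv.self_comp_symm, Function.comp_id] at h
    exact h
  choose X hX using hX
  -- Step 2: shifting the origin by one rotates the word
  obtain ⟨n, rfl⟩ : ∃ n, N = n + 1 := ⟨N - 1, by omega⟩
  have hrot : ∀ (k : ZMod (n + 1)) (τ : TensorIndex (ZMod (n + 1)) q),
      τ ∘ e (k + 1) = Fin.snoc (Fin.tail (τ ∘ e k)) ((τ ∘ e k) 0) := by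
    intro k τ
    funext i
    refine Fin.lastCases ?_ (fun i' => ?_) i
    · simp only [Function.comp_apply, Fin.snoc_last, he, Fin.val_last, Fin.val_zero,
        Nat.cast_zero, add_zero]
      have h1n : (1 : ZMod (n + 1)) + (n : ZMod (n + 1)) = 0 := by
        have h := ZMod.natCast_self (n + 1)
        push_cast at h
        linear_combination h
      congr 1
      rw [add_assoc, h1n, add_zero]
    · simp only [Function.comp_apply, Fin.snoc_castSucc, Fin.tail, he, Fin.val_castSucc,
        Fin.val_succ]
      congr 1
      push_cast
      ring
  -- Step 3: `X_k A^s = A^s X_{k+1}` ("no distinguished first position")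
  have key : ∀ (k : ZMod (n + 1)) (s : Fin q), X k * A s = A s * X (k + 1) := by
    intro k s
    refine eq_of_trace_mul_wordProduct_eq (hinj.of_le hm (by omega : m ≤ n)) fun w => ?_
    set τ : TensorIndex (ZMod (n + 1)) q := (Fin.cons s w : Fin (n + 1) → Fin q) ∘ (e k).symm
      with hτ
    have hτk : τ ∘ e k = Fin.cons s w := by
      rw [hτ, Function.comp_assoc, Equiv.symm_comp_self, Function.comp_id]
    have h1 := hX k τ
    have h2 := hX (k + 1) τ
    rw [hrot, hτk, Fin.tail_cons, Fin.cons_zero, wordProduct_snoc] at h2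
    rw [hτk, wordProduct_cons, h2] at h1
    rw [Matrix.mul_assoc, Matrix.mul_assoc, ← h1, trace_mul_cycle']
  -- Step 4: `X_0` commutes with every word of length `N`, hence is a scalar
  have hcomm : ∀ (ℓ : ℕ) (w : Fin ℓ → Fin q) (k : ZMod (n + 1)),
      X k * wordProduct A w = wordProduct A w * X (k + (ℓ : ZMod (n + 1))) := by
    intro ℓ
    induction ℓ with
    | zero =>
      intro w k
      simp [wordProduct]
    | succ ℓ ih =>
      intro w k
      rw [← Fin.cons_self_tail w, wordProduct_cons, ← Matrix.mul_assoc, key, Matrix.mul_assoc, ih,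
        Matrix.mul_assoc]
      congr 3
      push_cast
      ring
  have hcomm0 : ∀ w : Fin (n + 1) → Fin q, X 0 * wordProduct A w = wordProduct A w * X 0 := by
    intro w
    have h := hcomm (n + 1) w 0
    rwa [zero_add, ZMod.natCast_self] at h
  obtain ⟨c, hc⟩ :=
    exists_eq_smul_one_of_commute_wordProduct (hinj.of_le hm (by omega : m ≤ n + 1)) hcomm0
  -- Step 5: `φ = c • ψ`
  refine ⟨c, funext fun τ => ?_⟩
  have h0 : τ ∘ e 0 = τ ∘ ZMod.finEquiv (n + 1) := by
    funext i
    simp only [Function.comp_apply, he, zero_add, finEquiv_apply_eq_natCast]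
  show φ τ = c • mpsPeriodic (n + 1) A (τ ∘ ZMod.finEquiv (n + 1))
  rw [hX 0, hc, mpsPeriodic_apply, smul_eq_mul, Matrix.smul_mul, Matrix.one_mul, trace_smul,
    smul_eq_mul, h0]

/-! ### Discharge of `fannes_nachtergaele_werner_unique` -/

/-- **Discharge of `fannes_nachtergaele_werner_unique` (hubbard.S16; Fannes–Nachtergaele–Werner,
uniqueness and ground-state property of the parent Hamiltonian of a normal MPS on the ring).**
Let `A` be a normal tensor of positive bond dimension: its words of some positive length `m`
span `M_D(ℂ)` (`IsNormalMPS`), hence so do all words of length `≥ m`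
(`IsInjectiveMPS.of_le`). Take `ℓ₀ = m + 1`. For `ℓ ≥ ℓ₀` and a ring `ℤ/L` with `L ≥ 2ℓ`
(indeed `L ≥ ℓ` suffices), the parent Hamiltonian `H = Σ_x h_{x,…,x+ℓ-1} ≥ 0`
(`parentHamiltonian_posSemidef_holds`) annihilates the periodic MPS `ψ_L = ringMPS L A`
(`parentHamiltonian_mulVec_mps_eq_zero_holds`), which is nonzero (`ringMPS_ne_zero`), so the
ground energy is `0` (`groundEnergy_eq_of_posSemidef_sub`) and `ψ_L` is a ground-state vector;
and every zero-energy vector `φ` has all its `ℓ`-block slices in `𝒢_ℓ = ker h`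
(`exists_boundary_of_parentHamiltonian_mulVec_eq_zero'`), hence is a multiple of `ψ_L`
(`exists_eq_smul_ringMPS`: along the open chain read from any origin `φ ∈ 𝒢_L` by the
intersection property, FNW Lemma 5.5 / PVWC Thm 9, and the ring is closed up as in PVWC
Thm 10), so the ground space is the line `ℂ ψ_L` and the ground state is unique.
Perez-Garcia–Verstraete–Wolf–Cirac, *Matrix product state representations*, QIC **7** (2007)
401, §4.1.2 Theorem 10 (ring form: "`|ψ⟩` is the only ground state of `H_{𝒢_L}`" for
`L > L₀`, `N ≥ 2L₀`); Fannes–Nachtergaele–Werner, CMP **144** (1992) 443, Lemma 5.5 and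
Theorem 5.7 (infinite chain). [cite: PerezGarciaVerstraeteWolfCiracQIC2007, §4.1.2 Theorem 10] -/
theorem fannes_nachtergaele_werner_unique_holds :
    fannes_nachtergaele_werner_unique (q := q) (D := D) := by
  intro _ A hA
  obtain ⟨m, hm, hinj⟩ := hA
  refine ⟨m + 1, fun ℓ hℓ L _ hL => ?_⟩
  obtain ⟨m', rfl⟩ : ∃ m', ℓ = m' + 1 := ⟨ℓ - 1, by omega⟩
  have hinj' : IsInjectiveMPS A m' := hinj.of_le hm (by omega)
  have hm' : 0 < m' := by omega
  have hℓL : m' + 1 ≤ L := by omega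
  have hH0 : parentHamiltonian L (m' + 1) A *ᵥ ringMPS L A = 0 :=
    parentHamiltonian_mulVec_mps_eq_zero_holds L (m' + 1) hℓL A
  have hne : ringMPS L A ≠ 0 := ringMPS_ne_zero hinj' hm' L (by omega)
  have hpsd : (parentHamiltonian L (m' + 1) A).PosSemidef :=
    parentHamiltonian_posSemidef_holds L (m' + 1) A
  have hE : (parentHamiltonian L (m' + 1) A).groundEnergy = 0 := by
    refine groundEnergy_eq_of_posSemidef_sub hpsd.isHermitian 0 ?_ hne ?_
    · simpa using hpsd
    · rw [hH0, Complex.ofReal_zero, zero_smul]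
  have hGS : (parentHamiltonian L (m' + 1) A).groundSpace = ℂ ∙ ringMPS L A := by
    ext φ
    rw [mem_groundSpace_iff, hE, Complex.ofReal_zero, zero_smul, Submodule.mem_span_singleton]
    constructor
    · intro h0
      obtain ⟨c, hc⟩ := exists_eq_smul_ringMPS hinj' hm' L hℓL φ
        (exists_boundary_of_parentHamiltonian_mulVec_eq_zero' L hℓL A φ h0)
      exact ⟨c, hc.symm⟩
    · rintro ⟨c, rfl⟩
      rw [mulVec_smul, hH0, smul_zero]
  refine ⟨?_, hne, ?_⟩
  · rw [Matrix.HasUniqueGroundState, Matrix.groundStateDegeneracy, hGS,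
      finrank_span_singleton hne]
  · rw [hE, hH0, Complex.ofReal_zero, zero_smul]

end QLattice

end Literature.MathematicalPhysics.QuantumLattice
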